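import Summits.QuantumAdvantage.QuantumAdvantage.Theses.WhiteBoxWalk
import Literature.Computability.QuantumComplexity.BPPRelSubsetBQPRel
import Literature.Computability.Complexity.RandomizedProofs
import Literature.Computability.Cryptography.ShorDiscreteLogTheorem

/-!
# `WbwThesis` (stmt-QuantumAdvantage-2238) — I: read-back, load-bearing `IsPPT`, surplus strength of (C)

Support / negative lemmas for the crux `WbwThesis` (X, "planted unique-answer white-box quantum
advantage") of route `Summits/QuantumAdvantage/QuantumAdvantage/Theses/WhiteBoxWalk`, extracted from the
refuter work file `Summits/QuantumAdvantage/QuantumAdvantage/Cruxes/WbwThesis/Disproof.lean` (cycle 1,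
refuter-cdisprove-stmt-QuantumAdvantage-2238-0) so that planners, ideators and provers can IMPORT them.
Sorry-free; NO Theses decl is asserted positively (every statement is a refuted VARIANT of X, a necessary
condition on witnesses, or a consequence of X-type hypotheses). Sequel: `GuessingBound.lean` (II).

X = `∃ gen ans, gen ∈ FP ∧ (∃ p, ∀ s, |ans s| = p(|gen s|)) ∧ (Q) ∧ (C)`; (Q): one uniform oracle-free
Clifford+T family outputs `ans s` (prefix of the measured wires) with probability `≥ 2/3` on input
`gen s` for EVERY `s`; (C): every PPT given `⟨1ⁿ, gen s⟩`, `s` uniform in `{0,1}ⁿ`, outputs `ans s` with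
superpolynomially decaying probability.

* §0 `ClauseQ`, `ClauseC`, `wbwThesis_iff` (`Iff.rfl` read-back); `ans_eq_of_gen_eq` ((Q) makes answers
  a function of instances; twin of the lemma of the same name in `Theorems/WhiteBoxWalkWbwSearchToPromise`).
* §1 `dlog_clauseQ_shape`: Shor's discrete-log theorem of the tree (`isQSolvable_dlog_holds`,
  unconditional) has exactly the shape of clause (Q) — X for an FP generator of DLOG instances IS that
  generator's average-case DLOG assumption, so no unconditional `¬ X` is to be expected.
* §2 LOAD-BEARING `IsPPT`: `clauseC_false_forall_randAlg`, `wbwThesis_false_without_PPT` (the variant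
  stated inline) — with the PPT restriction dropped, (C) fails for every pair satisfying (Q) (table adversary, probability 1): (C) is a
  purely computational lower bound.
* §6 SURPLUS STRENGTH: `ClauseCwc`, `clauseCwc_of_clauseC` — (C) implies the WORST-CASE clause, which is
  all the glue `WbwSearchToPromise` consumes (information for the planner: X could be weakened there; the
  average-case surplus is what makes X an OWF-strength hypothesis, see II §4).
-/

set_option linter.dupNamespace false

namespace Summit.QuantumAdvantage.QuantumAdvantage.Theorems.WbwThesis.Negative

open Literature.Computability.Cryptography Literature.Computability.Complexity
open Literature.Computability.QuantumComplexity (kernelProb_add_kernelProb_le_one)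
open _root_.Computability Filter Asymptotics

/-! ## §0 Read-back: the two clauses -/

/-- Clause (Q) of `WbwThesis` for a fixed pair `(gen, ans)`: ONE uniform oracle-free Clifford+T family
outputs `ans s` (prefix of the measured wires) with probability `≥ 2/3` on input `gen s`, every `s`.
Verbatim sub-formula of the route decl. [folklore] -/
def ClauseQ (gen ans : List Bool → List Bool) : Prop :=
  ∃ F : QCircuitFamily cliffordT, F.IsOracleFree ∧ F.IsUniform ∧
    ∀ s, 2 / 3 ≤ F.kernelProb 0 (gen s) {y | ans s <+: y}

/-- Clause (C) of `WbwThesis` for a fixed pair `(gen, ans)` (same body as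
`WbwObfuscatedGluedTrees.Negative.ClauseC`; restated to keep this file's imports light). [folklore] -/
def ClauseC (gen ans : List Bool → List Bool) : Prop :=
  ∀ A : RandAlg (List Bool) (List Bool), IsPPT A id →
    SuperpolynomialDecay atTop (fun n : ℕ => (n : ℝ)) (fun n : ℕ =>
      uniformAvg n fun s => A.pr id (boolPair (unaryEncodeNat n) (gen s)) {y | ans s <+: y})

/-- READ-BACK: `WbwThesis ↔ ∃ gen ans, gen ∈ FP ∧ (∃ p, |ans s| = p(|gen s|)) ∧ ClauseQ ∧ ClauseC`,
definitionally. [folklore] -/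
theorem wbwThesis_iff :
    Summit.QuantumAdvantage.QuantumAdvantage.Theses.WhiteBoxWalk.WbwThesis ↔
      ∃ (gen ans : List Bool → List Bool), PolyTimeComputable id id gen ∧
        (∃ p : Polynomial ℕ, ∀ s, (ans s).length = p.eval (gen s).length) ∧
        ClauseQ gen ans ∧ ClauseC gen ans :=
  Iff.rfl

/-- **(Q) makes the answer a function of the instance** (twin of the tree's
`Theorems.WhiteBoxWalk.ans_eq_of_gen_eq` in `WhiteBoxWalkWbwSearchToPromise.lean`; same proof,
restated so that this file does not import the glue's heavy plumbing):
two distinct equal-length prefixes are disjoint events of probability `≥ 2/3` each. [folklore] -/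
theorem ans_eq_of_gen_eq {gen ans : List Bool → List Bool} {p : Polynomial ℕ}
    (hp : ∀ s, (ans s).length = p.eval (gen s).length) {F : QCircuitFamily cliffordT}
    (hQ : ∀ s, 2 / 3 ≤ F.kernelProb 0 (gen s) {y | ans s <+: y}) {s s' : List Bool}
    (h : gen s = gen s') : ans s = ans s' := by
  by_contra hne
  have hlen : (ans s).length = (ans s').length := by rw [hp, hp, h]
  have hdisj : Disjoint {y : List Bool | ans s <+: y} {y | ans s' <+: y} := by
    refine Set.disjoint_left.2 fun y h1 h2 => hne ?_
    exact (List.prefix_of_prefix_length_le h1 h2 hlen.le).eq_of_length hlen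
  have h1 := hQ s
  have h2 := hQ s'
  rw [← h] at h2
  have := kernelProb_add_kernelProb_le_one F 0 (gen s) hdisj
  linarith

/-- A sequence that is `≥ c > 0` infinitely often does not decay superpolynomially (twin of the
tree's `WbwObfuscatedGluedTrees.Negative.not_superpolynomialDecay_of_frequently_le`). [folklore] -/
theorem not_superpolynomialDecay_of_frequently_le {f : ℕ → ℝ} {c : ℝ} (hc : 0 < c)
    (h : ∃ᶠ n in atTop, c ≤ f n) : ¬ SuperpolynomialDecay atTop (fun n : ℕ => (n : ℝ)) f := by
  intro hdec
  have htend : Tendsto f atTop (nhds 0) := by simpa using hdec 0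
  have hev : ∀ᶠ n : ℕ in atTop, f n < c := htend.eventually (gt_mem_nhds hc)
  obtain ⟨n, hn, hlt⟩ := (h.and_eventually hev).exists
  exact absurd hlt (not_lt.2 hn)

/-! ## §1 Why no unconditional kill: Shor's DLOG theorem has the shape of clause (Q) -/

/-- **The quantum clause is unconditionally available for discrete logarithms** (tree theorem
`isQSolvable_dlog_holds`, Shor 1997 §6 / Kitaev 1995): some uniform oracle-free Clifford+T family
outputs, with probability `≥ 2/3`, a string with prefix `encodeNat a` (`g^a ≡ y mod p`) on every
encoded instance `⟨p, g, y⟩`. Consequently every FP generator of DLOG instances from uniform seeds,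
`gen s = encodeDLogInstance p g (g^a mod p)` with `ans s = encodeNat a`, satisfies (Q) (modulo the
classical-wrap plumbing of `WbwSearchToPromise`'s file), and X for it IS the average-case DLOG
assumption for that generator: an unconditional `¬ X` refutes every such assumption at once.
[cite: Shor1997, §6] -/
theorem dlog_clauseQ_shape :
    ∃ F : QCircuitFamily cliffordT, F.IsOracleFree ∧ F.IsUniform ∧
      ∀ x, 2 / 3 ≤ F.kernelProb 0 x {out | ∀ p g y : ℕ, x = encodeDLogInstance p g y →
        IsDLogInstance p g y → ∃ a ∈ dlogSolutions p g y, encodeNat a <+: out} :=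
  isQSolvable_dlog_holds

/-! ## §2 LOAD-BEARING `IsPPT`: unbounded adversaries win with probability one -/

/-- `RandAlg.pr` as a counting probability over the coin strings (tree lemma
`RandAlg.pr_eq_uniformProb`, re-derived to keep imports light). [folklore] -/
theorem pr_eq_uniformProb' {α β : Type} (A : RandAlg α β) (ea : α → List Bool) (x : α) (E : Set β) :
    A.pr ea x E = uniformProb (A.coinLen (ea x).length) {r : List Bool | A.run x r ∈ E} := by
  rw [uniformProb_eq_toOuterMeasure, RandAlg.pr, RandAlg.outputPMF, PMF.toOuterMeasure_map_apply]
  rfl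

open scoped Classical in
/-- The (information-theoretic, coin-free) TABLE ADVERSARY: on input `z`, if `z = ⟨1^{|s'|}, gen s'⟩`
for some seed `s'`, output `ans s'` (any choice), else `[]`. Well defined as an attack because answers
are a function of instances under (Q). [folklore] -/
noncomputable def tableAdversary (gen ans : List Bool → List Bool) : RandAlg (List Bool) (List Bool) where
  run z _ :=
    if h : ∃ s' : List Bool, boolPair (unaryEncodeNat s'.length) (gen s') = z then ans h.choose else []
  coinLen _ := 0

open scoped Classical in
/-- Under (Q) the table adversary outputs exactly `ans s` on `⟨1^{|s|}, gen s⟩` (every coin string).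
[folklore] -/
theorem tableAdversary_run_eq {gen ans : List Bool → List Bool} {p : Polynomial ℕ}
    (hp : ∀ s, (ans s).length = p.eval (gen s).length) {F : QCircuitFamily cliffordT}
    (hQ : ∀ s, 2 / 3 ≤ F.kernelProb 0 (gen s) {y | ans s <+: y}) (s r : List Bool) :
    (tableAdversary gen ans).run (boolPair (unaryEncodeNat s.length) (gen s)) r = ans s := by
  have h : ∃ s' : List Bool, boolPair (unaryEncodeNat s'.length) (gen s') =
      boolPair (unaryEncodeNat s.length) (gen s) := ⟨s, rfl⟩
  have hgen : gen h.choose = gen s := (QCircuit.boolPair_inj h.choose_spec).2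
  show (if h : ∃ s' : List Bool, boolPair (unaryEncodeNat s'.length) (gen s') =
      boolPair (unaryEncodeNat s.length) (gen s) then ans h.choose else []) = ans s
  rw [dif_pos h]
  exact ans_eq_of_gen_eq hp hQ hgen

/-- Under (Q) the table adversary outputs `ans s` on `⟨1^{|s|}, gen s⟩` with probability `1`.
[folklore] -/
theorem tableAdversary_pr {gen ans : List Bool → List Bool} {p : Polynomial ℕ}
    (hp : ∀ s, (ans s).length = p.eval (gen s).length) {F : QCircuitFamily cliffordT}
    (hQ : ∀ s, 2 / 3 ≤ F.kernelProb 0 (gen s) {y | ans s <+: y}) (s : List Bool) :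
    (tableAdversary gen ans).pr id (boolPair (unaryEncodeNat s.length) (gen s)) {y | ans s <+: y}
      = 1 := by
  rw [pr_eq_uniformProb']
  have hU : {r : List Bool | (tableAdversary gen ans).run (boolPair (unaryEncodeNat s.length) (gen s)) r
      ∈ {y : List Bool | ans s <+: y}} = Set.univ :=
    Set.eq_univ_of_forall fun r => by
      show ans s <+: (tableAdversary gen ans).run (boolPair (unaryEncodeNat s.length) (gen s)) r
      rw [tableAdversary_run_eq hp hQ s r]
  rw [hU, uniformProb_univ]

/-- **`IsPPT` is load-bearing**: for EVERY pair `(gen, ans)` satisfying (Q) (indeed for every pair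
whose answers are a function of the instances), clause (C) without the PPT restriction is FALSE —
the table adversary succeeds with probability `1` on every seed, so every uniform average is `1`.
[folklore] -/
theorem clauseC_false_forall_randAlg {gen ans : List Bool → List Bool} {p : Polynomial ℕ}
    (hp : ∀ s, (ans s).length = p.eval (gen s).length) {F : QCircuitFamily cliffordT}
    (hQ : ∀ s, 2 / 3 ≤ F.kernelProb 0 (gen s) {y | ans s <+: y}) :
    ¬ ∀ A : RandAlg (List Bool) (List Bool),
      SuperpolynomialDecay atTop (fun n : ℕ => (n : ℝ)) (fun n : ℕ =>
        uniformAvg n fun s => A.pr id (boolPair (unaryEncodeNat n) (gen s)) {y | ans s <+: y}) := by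
  intro hC
  refine not_superpolynomialDecay_of_frequently_le one_pos
    (Eventually.of_forall fun n => ?_).frequently (hC (tableAdversary gen ans))
  have h1 : ∀ x : List.Vector Bool n, (tableAdversary gen ans).pr id
      (boolPair (unaryEncodeNat n) (gen x.toList)) {y | ans x.toList <+: y} = 1 := fun x => by
    have := tableAdversary_pr hp hQ x.toList
    rwa [List.Vector.toList_length] at this
  simp only [uniformAvg, h1, Finset.sum_const, Finset.card_univ, card_vector, Fintype.card_bool,
    nsmul_eq_mul, mul_one]
  push_cast
  rw [div_self (by positivity)]

/-- **X without `IsPPT` is false** (`WbwThesis` with the restriction `IsPPT A id` on the classical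
adversary DROPPED, i.e. clause (C) demanded of EVERY `RandAlg`): any proof of X must use the
polynomial-time bound on the classical adversary — (C) is a purely computational lower bound (no
entropy is left in `ans s` given `gen s`). Stated inline (a refuted variant, not a named fact).
[folklore] -/
theorem wbwThesis_false_without_PPT :
    ¬ ∃ (gen ans : List Bool → List Bool), PolyTimeComputable id id gen ∧
      (∃ p : Polynomial ℕ, ∀ s, (ans s).length = p.eval (gen s).length) ∧
      ClauseQ gen ans ∧
      ∀ A : RandAlg (List Bool) (List Bool),
        SuperpolynomialDecay atTop (fun n : ℕ => (n : ℝ)) (fun n : ℕ =>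
          uniformAvg n fun s => A.pr id (boolPair (unaryEncodeNat n) (gen s)) {y | ans s <+: y}) := by
  rintro ⟨gen, ans, -, ⟨p, hp⟩, ⟨F, -, -, hQ⟩, hC⟩
  exact clauseC_false_forall_randAlg hp hQ hC

/-! ## §6 SURPLUS STRENGTH: the route consumes only WORST-CASE classical hardness -/

/-- The WORST-CASE classical clause: no PPT algorithm outputs `ans s` with probability `≥ 2/3` on
EVERY instance `⟨1^{|s|}, gen s⟩`. This is all the glue `WbwSearchToPromise` extracts from (C) (its PPT
built from `PromiseBQP ⊆ PromiseBPP'` succeeds on every seed with probability `≥ 2/3`). [folklore] -/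
def ClauseCwc (gen ans : List Bool → List Bool) : Prop :=
  ¬ ∃ A : RandAlg (List Bool) (List Bool), IsPPT A id ∧
      ∀ s, 2 / 3 ≤ A.pr id (boolPair (unaryEncodeNat s.length) (gen s)) {y | ans s <+: y}

/-- Uniform averages are monotone under a pointwise bound on strings of the averaged length.
[folklore] -/
theorem le_uniformAvg_of_forall {n : ℕ} {g : List Bool → ℝ} {c : ℝ}
    (h : ∀ s : List Bool, s.length = n → c ≤ g s) : c ≤ uniformAvg n g := by
  calc c = uniformAvg n fun _ => c := by
        simp only [uniformAvg, Finset.sum_const, Finset.card_univ, card_vector, Fintype.card_bool,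
          nsmul_eq_mul]
        push_cast
        rw [eq_div_iff (by positivity), mul_comm]
    _ ≤ uniformAvg n g := by
        unfold uniformAvg
        exact div_le_div_of_nonneg_right (Finset.sum_le_sum fun x _ => h x.toList (by simp))
          (by positivity)

/-- **(C) is stronger than what the route uses**: average-case negligible success implies worst-case
failure (`ClauseC → ClauseCwc`), and the deciding theorem `WhiteBoxWalk.closes` consumes X only through
`WbwSearchToPromise`, whose proof needs no more than `ClauseCwc`. Information for the planner
("hypothesis possibly unnecessary"): the target could be weakened to `∃ gen ans, FP ∧ length ∧ (Q) ∧
ClauseCwc` — a samplable-promise form of `PromiseBQP ⊄ PromiseBPP` — without touching the assembly; the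
average-case surplus is exactly what makes X a CRYPTOGRAPHIC (OWF-strength, §4) rather than a
complexity-theoretic separation. [folklore] -/
theorem clauseCwc_of_clauseC {gen ans : List Bool → List Bool} (hC : ClauseC gen ans) :
    ClauseCwc gen ans := by
  rintro ⟨A, hA, hwin⟩
  refine not_superpolynomialDecay_of_frequently_le (by norm_num : (0 : ℝ) < 2 / 3)
    (Eventually.of_forall fun n => ?_).frequently (hC A hA)
  exact le_uniformAvg_of_forall fun s hs => by simpa [hs] using hwin s

end Summit.QuantumAdvantage.QuantumAdvantage.Theorems.WbwThesis.Negative
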